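import Summits.ValiantsHypothesis.ValiantsHypothesis.Theorems.LacunarySymmetroidMatrixDescartesPivotStaircaseAllKSlack
import Summits.ValiantsHypothesis.ValiantsHypothesis.Theorems.LacunarySymmetroidMatrixDescartesCensusPivotKit
import Summits.ValiantsHypothesis.ValiantsHypothesis.Theorems.LacunarySymmetroidMatrixDescartesCensusPivotTwoDescartes
import Summits.ValiantsHypothesis.ValiantsHypothesis.Theorems.LacunarySymmetroidMatrixDescartesCensusPivotBridge
import Summits.ValiantsHypothesis.ValiantsHypothesis.Theorems.LacunarySymmetroidMatrixDescartesCensusPivotNormalForm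

/-!
# `MatrixDescartes` (stmt-ValiantsHypothesis-18050) — THE `m = 2` INDEX-ONE PIVOT ROW FOR EVERY `K`:
# `Z₊ ≥ 2K` by a POLE-WEAVING family, hence `RankOneStaircase` HOLDS and the row is pinned in `[2K, 2K + 2]`

HONEST FRAMING.  Cell `pub-symmetroid`, seat `val-sym-mdr-p2` (gen 24); helper file `--supports` the crux
`Theses.LacunarySymmetroid.MatrixDescartes` (OPEN), NO closure claim.  Currency: conjb-1's pivot column
(`…CensusPivotDefs`: `pivotPosRoots`, `PivotRootLawAt`, the named rows).  The tree knew the `m = 2` index-one row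
`(2, K)₁` from ABOVE for every `K` (R1₂ `rankOnePivotLawTwo_holds`: `Z₊ ≤ 2K + 2`, conjb-1 g0) but from BELOW only for
`K ≤ 6` (staircase members `5, 7, 9`; balanced blocks `4, 6, 8, 10, 12`); the family statement
`RankOneStaircase : ∀ K ≥ 4, ¬ PivotRootLawAt 2 K 1 (2K − 4)` was «OPEN as a family».  This file proves, for EVERY `K ≥ 2`,
**`not_pivotRootLawAt_two_indexOne : ¬ PivotRootLawAt 2 K 1 (2K − 1)`** — `Z₊ ≥ 2K` is attained at `(2, K)`, index one,
with DIAGONAL letters; this is exactly the budget `2(m−1)(K−1) + 2 = 2K` of the typed bilinear guess R1‴ at `m = 2` — whence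
**`rankOneStaircase_holds : RankOneStaircase`** and the two-sided pin **`two_indexOne_row_pinned`:
`PivotRootLawAt 2 K 1 B → 2K ≤ B`, and `PivotRootLawAt 2 K 1 (2K + 2)`** — the `m = 2` index-one row lies in `[2K, 2K + 2]`
for ALL `K`.  Since the letters are diagonal, the same object prices the diagonal-channel rung: no `m = 2` diagonal-letter
index-one law has budget below `2K` (`diagonal_two_indexOne_needs`; `DiagonalRankOneLaw` allows `4(K+1) + 2`).
Nothing here bears on `MatrixDescartes` in its window, on the UPPER rungs R1″/R1‴/R1‴b/R1′ (all OPEN), on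
`DoorA26`/`DoorA34` (a pivot count is not a `ζ_sym` row), on the registers, or on `VP ≠ VNP`.

THE OBJECT (POLE WEAVING).  Size `2`, pivot exponent `1`, pivot letter `J = [[−1, 1], [1, 0]]` (index one:
`J + w wᵀ = diag(3, 1/4)` for `w = (2, −1/2)`), one PSD letter `diag(1, 1/32)` BELOW the pivot (exponent `0`) and `c = K − 1`
PSD letters `diag(ε, 8nᵢ)` ABOVE it at the exponents `nᵢ = M^{i+1}`, `M = S²`, `S = 2^{c+7}`, `ε = 1/(512 (c+1)² M^c)` (`i < c`).  Then
    `det F(x) = (1 − x + ε·Σᵢ x^{nᵢ}) · (1/32 + Σᵢ 8nᵢ x^{nᵢ}) − x²`.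
Without the two slacks `1/32`, `ε` this is `(1 − x)·C(x) − x²`, `C(x) = Σᵢ 8nᵢ x^{nᵢ}`: its roots are the points where the
lacunary posynomial `C` meets `x²/(1 − x) = Σ_{j≥2} x^j`; the bump `8nᵢ x^{nᵢ}(1 − x)` peaks at `1 − 1/(2nᵢ)` with value
`≥ 2 > x²`, while at `1/2` and at the valleys `1 − 1/(S nᵢ)` every bump is `≤ 1/(8(c+1))` (companion `…AllKCalculus`), so the
determinant alternates `−,+,−,…,+,−` along `2c + 1` points of `(1/2, 1)`: `2c = 2K − 2` roots (Descartes-sharp for one below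
letter).  The slacks make the two END letters rank two and buy the two END crossings: `det F(1/16) > 0` (the `1/32`) and
`det F(R) > 0` at `R = 2/ε` (the `ε x^{n_{c−1}}` in the corner entry), while moving no interior sign: `2K` roots in `(1/16, R)`.
MECHANISM (for the census): all interior roots live in ONE scale window below the pole of the lower factor `1 − x`;
scale-separated letters can never do this (far windows are one-sided), which is why every earlier certificate had its roots
clustered «just below the pole of the lower factor» (`…PivotTwoSixTwelve`).

[folklore] Bernoulli's inequality, `(1 − 1/N)^{N} ≤ e^{−1}`, `e^L ≥ L²/2`, the intermediate value theorem (tree kit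
`Pivot.le_pivotPosRoots_of_certificate`); the object is this seat's.
-/

set_option linter.dupNamespace false

namespace Summit.ValiantsHypothesis.ValiantsHypothesis.Theorems.LacunarySymmetroidMatrixDescartes.Pivot

open scoped BigOperators Matrix
open Finset

namespace PoleWeave

/-! ### Notation (as in `…PivotStaircaseAllKCalculus` / `…Slack`; local, no definitions) -/

/-- The scale `S = 2^{c+7}`. -/
local notation3 (prettyPrint := false) "S⟦" c "⟧" => (2 ^ (c + 7))

/-- The exponents `nᵢ = (S²)^{i+1}`. -/
local notation3 (prettyPrint := false) "n⟦" c ", " i "⟧" => ((S⟦c⟧ * S⟦c⟧) ^ (i + 1))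

/-- The top exponent `T = (S²)^c`. -/
local notation3 (prettyPrint := false) "T⟦" c "⟧" => ((S⟦c⟧ * S⟦c⟧) ^ c)

/-- The gaps `ω_j` of the interior weaving points (`ω₀ = 1/2`, `ω_{2i+1} = 1/(2nᵢ)`, `ω_{2i+2} = 1/(S nᵢ)`). -/
local notation3 (prettyPrint := false) "ω⟦" c ", " j "⟧" =>
  (if j = 0 then ((1 : ℝ) / 2)
    else if j % 2 = 1 then (1 : ℝ) / (2 * (n⟦c, j / 2⟧ : ℝ))
    else (1 : ℝ) / ((S⟦c⟧ * n⟦c, j / 2 - 1⟧ : ℕ) : ℝ))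

/-- The corner slack `ε = 1/(512 (c+1)² T)`. -/
local notation3 (prettyPrint := false) "ε⟦" c "⟧" => ((1 : ℝ) / (512 * ((c : ℝ) + 1) ^ 2 * (T⟦c⟧ : ℝ)))

/-- The right end point `R = 1024 (c+1)² T = 2/ε`. -/
local notation3 (prettyPrint := false) "R⟦" c "⟧" => ((1024 : ℝ) * ((c : ℝ) + 1) ^ 2 * (T⟦c⟧ : ℝ))

/-- The closed form with slacks: `gs(t) = (1 − t + ε Σᵢ t^{nᵢ})·(1/32 + Σᵢ 8nᵢ t^{nᵢ}) − t²`. -/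
local notation3 (prettyPrint := false) "gs⟦" c "⟧(" t ")" =>
  ((1 - t + ε⟦c⟧ * ∑ i : Fin c, t ^ (n⟦c, (i : ℕ)⟧)) *
      ((1 : ℝ) / 32 + ∑ i : Fin c, (8 * (n⟦c, (i : ℕ)⟧ : ℝ)) * t ^ (n⟦c, (i : ℕ)⟧)) - t ^ 2)

/-- The weaving points: `τ₀ = 1/16`, `τ_{j+1} = 1 − ω_j` (`j ≤ 2c`), `τ_{2c+2} = R`. -/
local notation3 (prettyPrint := false) "τ⟦" c ", " j "⟧" =>
  (if j = 0 then ((1 : ℝ) / 16) else if j = 2 * c + 2 then R⟦c⟧ else 1 - ω⟦c, j - 1⟧)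

/-! ### 3. The pole-weaving pencil and its determinant -/

/-- The pivot letter `J = [[−1, 1], [1, 0]]` (local notation). -/
local notation3 (prettyPrint := false) "Jw" => (!![-1, 1; 1, 0] : Matrix (Fin 2) (Fin 2) ℝ)

/-- The `K = c + 1` PSD letters: `diag(1, 1/32)` at exponent `0`, then `diag(ε, 8nᵢ)` at exponent `nᵢ` (local notation). -/
local notation3 (prettyPrint := false) "Pw⟦" c "⟧" =>
  (Fin.cons (Matrix.diagonal ![(1 : ℝ), 1 / 32])
    (fun i : Fin c => Matrix.diagonal ![ε⟦c⟧, 8 * (n⟦c, (i : ℕ)⟧ : ℝ)]) :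
      Fin (c + 1) → Matrix (Fin 2) (Fin 2) ℝ)

/-- The exponents `(0, n₀, …, n_{c−1})` (local notation). -/
local notation3 (prettyPrint := false) "dw⟦" c "⟧" =>
  (Fin.cons 0 (fun i : Fin c => n⟦c, (i : ℕ)⟧) : Fin (c + 1) → ℕ)

/-- The index-one witness `w = (2, −1/2)ᵀ` (local notation). -/
local notation3 (prettyPrint := false) "Ww" =>
  (Matrix.of fun (i : Fin 2) (_ : Fin 1) => (![(2 : ℝ), -1 / 2] : Fin 2 → ℝ) i)

/-- **Closed form**: `det (t • J + diag(1, 1/32) + Σᵢ t^{nᵢ} diag(ε, 8nᵢ)) = gs(t)`. [folklore] -/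
theorem det_eq (c : ℕ) (t : ℝ) : (t ^ 1 • Jw + ∑ k, t ^ (dw⟦c⟧ k) • Pw⟦c⟧ k).det = gs⟦c⟧(t) := by
  rw [Fin.sum_univ_succ]
  simp only [Fin.cons_zero, Fin.cons_succ, pow_zero, one_smul, pow_one]
  rw [Matrix.det_fin_two]
  have h11 : (∑ i : Fin c, t ^ (n⟦c, (i : ℕ)⟧) • Matrix.diagonal ![ε⟦c⟧, 8 * (n⟦c, (i : ℕ)⟧ : ℝ)]) 1 1
      = ∑ i : Fin c, (8 * (n⟦c, (i : ℕ)⟧ : ℝ)) * t ^ (n⟦c, (i : ℕ)⟧) := by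
    rw [Matrix.sum_apply]
    refine Finset.sum_congr rfl fun i _ => ?_
    simp [Matrix.smul_apply, mul_comm]
  have h00 : (∑ i : Fin c, t ^ (n⟦c, (i : ℕ)⟧) • Matrix.diagonal ![ε⟦c⟧, 8 * (n⟦c, (i : ℕ)⟧ : ℝ)]) 0 0
      = ε⟦c⟧ * ∑ i : Fin c, t ^ (n⟦c, (i : ℕ)⟧) := by
    rw [Matrix.sum_apply, Finset.mul_sum]
    refine Finset.sum_congr rfl fun i _ => ?_
    simp [Matrix.smul_apply, mul_comm]
  have h01 : (∑ i : Fin c, t ^ (n⟦c, (i : ℕ)⟧) • Matrix.diagonal ![ε⟦c⟧, 8 * (n⟦c, (i : ℕ)⟧ : ℝ)]) 0 1 = 0 := by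
    rw [Matrix.sum_apply]; simp [Matrix.smul_apply]
  have h10 : (∑ i : Fin c, t ^ (n⟦c, (i : ℕ)⟧) • Matrix.diagonal ![ε⟦c⟧, 8 * (n⟦c, (i : ℕ)⟧ : ℝ)]) 1 0 = 0 := by
    rw [Matrix.sum_apply]; simp [Matrix.smul_apply]
  simp only [Matrix.add_apply, Matrix.smul_apply]
  rw [h00, h01, h10, h11]
  simp
  ring

/-- `J` is symmetric. -/
theorem isSymm_J : (Jw).IsSymm := by
  unfold Matrix.IsSymm; ext i j; fin_cases i <;> fin_cases j <;> rfl

/-- The letters are positive semidefinite. -/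
theorem posSemidef_P (c : ℕ) (k : Fin (c + 1)) : (Pw⟦c⟧ k).PosSemidef := by
  refine Fin.cases ?_ (fun i => ?_) k
  · simp only [Fin.cons_zero]
    rw [Matrix.posSemidef_diagonal_iff]
    intro l
    fin_cases l
    · simp
    · simp
  · simp only [Fin.cons_succ]
    rw [Matrix.posSemidef_diagonal_iff]
    intro l
    fin_cases l
    · have h : (0 : ℝ) ≤ ε⟦c⟧ := by positivity
      simpa using h
    · have h8 : (0 : ℝ) ≤ 8 * (n⟦c, (i : ℕ)⟧ : ℝ) := by positivity
      simpa using h8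

/-- The letters are DIAGONAL. -/
theorem diagonal_P (c : ℕ) (k : Fin (c + 1)) (a b : Fin 2) (hab : a ≠ b) : Pw⟦c⟧ k a b = 0 := by
  refine Fin.cases ?_ (fun i => ?_) k
  · simp only [Fin.cons_zero]; exact Matrix.diagonal_apply_ne _ hab
  · simp only [Fin.cons_succ]; exact Matrix.diagonal_apply_ne _ hab

/-- The pivot has index one: `J + w wᵀ = diag(3, 1/4) ⪰ 0` for `w = (2, −1/2)`. -/
theorem indexOne_J : (Jw + Ww * Wwᵀ).PosSemidef := by
  have h : Jw + Ww * Wwᵀ = Matrix.diagonal ![(3 : ℝ), 1 / 4] := by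
    ext i j
    fin_cases i <;> fin_cases j <;> simp [Matrix.mul_apply] <;> norm_num
  rw [h, Matrix.posSemidef_diagonal_iff]
  intro i; fin_cases i <;> simp

/-! ### 4. The count and the packaged object -/

/-- **`Z₊ ≥ 2c + 2` at `(2, c+1)`, index one, diagonal letters** (`c ≥ 1`): the pole-weaving pencil has at least
`2c + 2` distinct positive determinant roots. -/
theorem le_pivotPosRoots (c : ℕ) (hc : 1 ≤ c) : 2 * c + 2 ≤ pivotPosRoots 1 (dw⟦c⟧) Jw (Pw⟦c⟧) := by
  refine le_pivotPosRoots_of_certificate (det_eq c) (fun j : Fin (2 * c + 2 + 1) => τ⟦c, (j : ℕ)⟧)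
    (Fin.strictMono_iff_lt_succ.2 fun j => ?_) (fun j => τ_pos c j (by omega)) (fun j => ?_)
  · simp only [Fin.val_castSucc, Fin.val_succ]
    exact τ_succ_lt c j j.isLt
  · simp only [Fin.val_castSucc, Fin.val_succ]
    exact gs_alternates c j hc j.isLt

/-- **The pole-weaving object, packaged**: for every `c ≥ 1` a `2 × 2` pivot pencil with pivot exponent `1`, symmetric
pivot letter of index one, `c + 1` DIAGONAL PSD letters, and `≥ 2c + 2` distinct positive determinant roots. -/
theorem exists_poleWeave (c : ℕ) (hc : 1 ≤ c) :
    ∃ (d : Fin (c + 1) → ℕ) (J : Matrix (Fin 2) (Fin 2) ℝ) (P : Fin (c + 1) → Matrix (Fin 2) (Fin 2) ℝ),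
      J.IsSymm ∧ (∀ k, (P k).PosSemidef) ∧ (∀ k i j, i ≠ j → P k i j = 0) ∧
      (∃ W : Matrix (Fin 2) (Fin 1) ℝ, (J + W * Wᵀ).PosSemidef) ∧ 2 * c + 2 ≤ pivotPosRoots 1 d J P :=
  ⟨dw⟦c⟧, Jw, Pw⟦c⟧, isSymm_J, posSemidef_P c, fun k i j hij => diagonal_P c k i j hij, ⟨Ww, indexOne_J⟩,
    le_pivotPosRoots c hc⟩

end PoleWeave

/-! ### 5. The theorems of the column -/

/-- **THE `m = 2` INDEX-ONE ROW FROM BELOW, FOR EVERY `K`.**  For every `K ≥ 2` the row «`Z₊ ≤ 2K − 1`» FAILS at format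
`(2, K)`, pivot index `1`: the pole-weaving pencil (diagonal letters) has `≥ 2K` distinct positive roots — the budget
`2(m−1)(K−1) + 2` of R1‴ `RankOnePivotLawBilinear` at `m = 2`, now attained for every `K` (the tree had `K ≤ 6`). -/
theorem not_pivotRootLawAt_two_indexOne (K : ℕ) (hK : 2 ≤ K) : ¬ PivotRootLawAt 2 K 1 (2 * K - 1) := by
  obtain ⟨c, rfl⟩ : ∃ c, K = c + 1 := ⟨K - 1, by omega⟩
  obtain ⟨d, J, P, hJ, hP, -, hW, hle⟩ := PoleWeave.exists_poleWeave c (by omega)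
  intro h
  have h1 := h 1 d J P hJ hP hW
  omega

/-- **`RankOneStaircase` HOLDS** (`…CensusPivotDefs`, conjb-1 g0, «OPEN as a family» until now; members `K = 4, 5, 6`
were certified one by one): at `m = 2`, index `1`, `K ≥ 4` PSD letters allow `≥ 2K − 3` positive roots — indeed `≥ 2K`. -/
theorem rankOneStaircase_holds : RankOneStaircase := fun K hK h =>
  not_pivotRootLawAt_two_indexOne K (by omega) (pivotRootLawAt_mono h (by omega))

/-- Budget form: any valid `m = 2` index-one row at `K ≥ 2` letters has budget `≥ 2K`. -/
theorem le_of_pivotRootLawAt_two_indexOne {K B : ℕ} (hK : 2 ≤ K) (h : PivotRootLawAt 2 K 1 B) : 2 * K ≤ B := by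
  by_contra hB
  exact not_pivotRootLawAt_two_indexOne K hK (pivotRootLawAt_mono h (by omega))

/-- **THE `m = 2` INDEX-ONE ROW IS PINNED IN `[2K, 2K + 2]` FOR EVERY `K ≥ 2`**: the lower end by pole weaving (this file),
the upper end by conjb-1 g0's Descartes count R1₂ (`pivotRootLawAt_two`).  The typed bilinear guess R1‴ predicts `2K`. -/
theorem two_indexOne_row_pinned (K : ℕ) (hK : 2 ≤ K) :
    (∀ B, PivotRootLawAt 2 K 1 B → 2 * K ≤ B) ∧ PivotRootLawAt 2 K 1 (2 * K + 2) :=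
  ⟨fun _ h => le_of_pivotRootLawAt_two_indexOne hK h, pivotRootLawAt_two K 1⟩

/-- `R1‴` at `m = 2` would be EXACT: `RankOnePivotLawBilinear → (PivotRootLawAt 2 K 1 B ↔ 2K ≤ B)` for `K ≥ 2`
(its budget `2·(2−1)·(K−1) + 2 = 2K` is attained for every `K`).  Nothing asserts R1‴. -/
theorem two_indexOne_row_iff_of_bilinear (h : RankOnePivotLawBilinear) {K B : ℕ} (hK : 2 ≤ K) :
    PivotRootLawAt 2 K 1 B ↔ 2 * K ≤ B := by
  refine ⟨le_of_pivotRootLawAt_two_indexOne hK, fun hB => pivotRootLawAt_mono (h 2 K) ?_⟩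
  have : 2 * (2 - 1) * (K - 1) + 2 = 2 * K := by omega
  omega

/-- Propagation to every larger size and index (zero padding, tree `pivotRootLawAt_of_le_size` /
`pivotRootLawAt_of_le_index`): for `m ≥ 2`, `q ≥ 1`, `K ≥ 2` the row «`Z₊ ≤ 2K − 1`» fails at `(m, K)`, index `q`. -/
theorem not_pivotRootLawAt_of_two_le {m K q : ℕ} (hm : 2 ≤ m) (hK : 2 ≤ K) (hq : 1 ≤ q) :
    ¬ PivotRootLawAt m K q (2 * K - 1) := by
  intro h
  obtain ⟨r, rfl⟩ := Nat.exists_eq_add_of_le hq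
  exact not_pivotRootLawAt_two_indexOne K hK (pivotRootLawAt_of_le_size hm (pivotRootLawAt_of_le_index h))

/-- **The price of the diagonal-channel rung at `m = 2`.**  `DiagonalRankOneLaw` (`…CensusPivotDefs`, OPEN) asks for
`Z₊ ≤ m²(K+1) + 2` when all PSD letters are diagonal; at `m = 2` no diagonal-letter index-one law can have budget below `2K`:
for every `c ≥ 1` there is a `2 × 2` index-one pivot pencil with `c + 1` DIAGONAL PSD letters and `≥ 2c + 2` positive roots. -/
theorem diagonal_two_indexOne_needs (c : ℕ) (hc : 1 ≤ c) :
    ∃ (e : ℕ) (d : Fin (c + 1) → ℕ) (J : Matrix (Fin 2) (Fin 2) ℝ) (P : Fin (c + 1) → Matrix (Fin 2) (Fin 2) ℝ),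
      J.IsSymm ∧ (∀ k, (P k).PosSemidef) ∧ (∀ k i j, i ≠ j → P k i j = 0) ∧
      (∃ W : Matrix (Fin 2) (Fin 1) ℝ, (J + W * Wᵀ).PosSemidef) ∧ 2 * c + 2 ≤ pivotPosRoots e d J P :=
  ⟨1, PoleWeave.exists_poleWeave c hc⟩

end Summit.ValiantsHypothesis.ValiantsHypothesis.Theorems.LacunarySymmetroidMatrixDescartes.Pivot
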